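import Literature.Computability.Complexity.ExtMonotoneCliqueGate
import Literature.Computability.Complexity.CircuitLowerBoundsProofs
import Literature.Computability.AlgebraicComplexity.DeterminantalComplexityProofs

/-!
# PneNP / ConvexRankGates — crux `LinAlgGateBlind` (stmt-PneNP-10681), negative side, II:
# the clique polynomial, its monotone shadow, and a size-tracked determinantal representation

Negative-side support (standing disprover, `Cruxes/LinAlgGateBlind/Disproof.lean`).
* `cliquePoly m F k = Σ_{|T|=k} Π_{e ⊆ T} X_e` over a field `F`, in the edge variables of `K_m`
  enumerated by `CliqueLPGate.eE m` (`liveIdx`, `liveSupp`).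
* `shadow_cliquePoly_iff` — for `k ≥ 2` its monotone shadow (up-closure of monomial supports) is
  `CLIQUE(m,k)` (`mem_support_cliquePoly_iff`, injectivity `eq_of_liveSupp_eq`); for `k ≤ 1` it is
  the CONSTANT `C(m,k)` (`cliquePoly_of_le_one`), which dies in characteristic `p ∣ C(m,k)` — so the
  hypothesis `k ≥ 2` is necessary.
* `hasDetRepr_cliquePoly` — `dc(CL_{m,k}) ≤ 1 + C(m,k)·#E(K_m)`, by SIZE-TRACKED Valiant gadgets
  (local notation `GadgetC[N, g]`; one path block per monomial, `det_pathBorder_add_single` of the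
  tree; the tree's universality `exists_hasDetRepr_holds` records no size).
-/

namespace Summit.PneNP.PneNP.Theorems.LinAlgGateBlind.Negative

open Literature.Computability.Complexity MvPolynomial

/-! ### Size-tracked Valiant gadgets (ABP → determinant) -/

section Gadget

variable {R : Type*} [CommRing R] {σ : Type*}

/- A *gadget of size `N`* for `g` (local NOTATION, not a declaration): an affine `N × N` matrix `M`
(up to the index type) with a distinguished index `z` such that `det (M + c E_{zz}) = c + g` for all
`c` — Valiant's ABP matrix with source and sink glued at `z`; the size-tracked form of the tree's
universality gadgets (`exists_gadget_*`, `DeterminantalComplexityProofs.lean`). -/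
set_option hygiene false in
local notation "GadgetC[" N ", " g "]" =>
  (∃ (ι : Type) (_ : Fintype ι) (_ : DecidableEq ι), Fintype.card ι = N ∧
    ∃ (z : ι) (M : Matrix ι ι (MvPolynomial σ R)),
      (∀ p q, (M p q).totalDegree ≤ 1) ∧ ∀ c, (M + Matrix.single z z c).det = c + g)

/-- The `1 × 1` zero matrix is a gadget of size `1` for `0`. [folklore] -/
theorem gadgetC_zero : GadgetC[1, (0 : MvPolynomial σ R)] :=
  ⟨Unit, inferInstance, inferInstance, by simp, (), 0, fun p q => by simp, fun c => by
    simp [Matrix.det_unique]⟩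

/-- Adding an affine form costs nothing. [folklore] -/
theorem gadgetC_add_affine {N : ℕ} {g a : MvPolynomial σ R} (ha : a.totalDegree ≤ 1)
    (h : GadgetC[N, g]) : GadgetC[N, g + a] := by
  obtain ⟨ι, _, _, hN, z, M, hdeg, hdet⟩ := h
  refine ⟨ι, inferInstance, inferInstance, hN, z, M + Matrix.single z z a, fun p q => ?_,
    fun c => ?_⟩
  · rw [Matrix.add_apply, Matrix.single_apply]
    split_ifs
    · exact (totalDegree_add _ _).trans (max_le (hdeg p q) ha)
    · rw [add_zero]
      exact hdeg p q
  · rw [add_assoc, ← Matrix.single_add, hdet]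
    ring

/-- Adding a product of `t + 2` affine forms costs `t + 1` rows (the path block of
`det_pathBorder_add_single`; Valiant 1979, §2). [folklore] -/
theorem gadgetC_add_prod {N : ℕ} {g : MvPolynomial σ R} (y : ℕ → MvPolynomial σ R)
    (hy : ∀ i, (y i).totalDegree ≤ 1) (t : ℕ) (h : GadgetC[N, g]) :
    GadgetC[N + (t + 1), g + ∏ i ∈ Finset.range (t + 2), y i] := by
  obtain ⟨ι, _, _, hN, z, M, hdeg, hdet⟩ := h
  let U : Matrix (Fin (t + 1)) (Fin (t + 1)) (MvPolynomial σ R) := Matrix.of fun a b =>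
    if (b : ℕ) = a then 1 else if (b : ℕ) = a + 1 then -y b else 0
  let W : Matrix (Fin (t + 1)) (Fin (t + 1)) (MvPolynomial σ R) := Matrix.of fun a b =>
    if (a : ℕ) ≤ b then ∏ i ∈ Finset.Ioc (a : ℕ) b, y i else 0
  have hU : ∀ a b, U a b = if (b : ℕ) = a then 1 else if (b : ℕ) = a + 1 then -y b else 0 :=
    fun a b => rfl
  have hW : ∀ a b, W a b = if (a : ℕ) ≤ b then ∏ i ∈ Finset.Ioc (a : ℕ) b, y i else 0 :=
    fun a b => rfl
  refine ⟨ι ⊕ Fin (t + 1), inferInstance, inferInstance, by simp [Fintype.card_sum, hN],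
    Sum.inl z,
    Matrix.fromBlocks M (Matrix.single z (0 : Fin (t + 1)) (-y 0))
      (Matrix.single (Fin.last t) z (y (t + 1))) U, ?_, fun c => ?_⟩
  · rintro (p | p) (q | q)
    · rw [Matrix.fromBlocks_apply₁₁]
      exact hdeg p q
    · rw [Matrix.fromBlocks_apply₁₂, Matrix.single_apply]
      split_ifs
      · rw [totalDegree_neg]
        exact hy 0
      · simp
    · rw [Matrix.fromBlocks_apply₂₁, Matrix.single_apply]
      split_ifs
      · exact hy (t + 1)
      · simp
    · rw [Matrix.fromBlocks_apply₂₂, hU]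
      split_ifs
      · simp
      · rw [totalDegree_neg]
        exact hy q
      · simp
  · rw [Literature.Computability.AlgebraicComplexity.det_pathBorder_add_single M z y c hU hW, hdet]
    ring

/-- Adding the product of a list of affine forms costs `|l| - 1` rows. [folklore] -/
theorem gadgetC_add_listProd {N : ℕ} {g : MvPolynomial σ R} (l : List (MvPolynomial σ R))
    (hl : ∀ y ∈ l, y.totalDegree ≤ 1) (h : GadgetC[N, g]) :
    GadgetC[N + (l.length - 1), g + l.prod] := by
  rcases l with _ | ⟨x, _ | ⟨x', rest⟩⟩
  · rw [List.prod_nil]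
    exact gadgetC_add_affine (by simp) h
  · rw [List.prod_cons, List.prod_nil, mul_one]
    exact gadgetC_add_affine (hl x (by simp)) h
  · have hy : ∀ i, ((x :: x' :: rest).getD i 1).totalDegree ≤ 1 := by
      intro i
      rw [List.getD_eq_getElem?_getD]
      by_cases hi : i < (x :: x' :: rest).length
      · rw [List.getElem?_eq_getElem hi, Option.getD_some]
        exact hl _ (List.getElem_mem hi)
      · rw [List.getElem?_eq_none (by omega), Option.getD_none]
        simp
    have := gadgetC_add_prod (fun i => (x :: x' :: rest).getD i 1) hy rest.length h
    rwa [show rest.length + 2 = (x :: x' :: rest).length by simp,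
      Literature.Computability.AlgebraicComplexity.prod_range_getD_one] at this

/-- Adding a finite sum of list-products of affine forms, lists of length `≤ B + 1`: at most
`B` rows per summand. [folklore] -/
theorem gadgetC_add_sum_listProd {α : Type*} [DecidableEq α] (s : Finset α)
    (ls : α → List (MvPolynomial σ R)) (B : ℕ) (hl : ∀ a ∈ s, ∀ y ∈ ls a, y.totalDegree ≤ 1)
    (hB : ∀ a ∈ s, (ls a).length ≤ B + 1) {N : ℕ} {g : MvPolynomial σ R} (h : GadgetC[N, g]) :
    ∃ N', N' ≤ N + s.card * B ∧ GadgetC[N', g + ∑ a ∈ s, (ls a).prod] := by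
  induction s using Finset.induction_on generalizing N g with
  | empty => exact ⟨N, by simp, by simpa using h⟩
  | insert a s has ih =>
    obtain ⟨N', hN', hg'⟩ := ih (fun b hb => hl b (Finset.mem_insert_of_mem hb))
      (fun b hb => hB b (Finset.mem_insert_of_mem hb)) h
    have h2 := gadgetC_add_listProd (ls a) (hl a (Finset.mem_insert_self a s)) hg'
    refine ⟨N' + ((ls a).length - 1), ?_, ?_⟩
    · have := hB a (Finset.mem_insert_self a s)
      rw [Finset.card_insert_of_notMem has]
      have : (ls a).length - 1 ≤ B := by omega
      nlinarith
    · rwa [Finset.sum_insert has, add_comm (ls a).prod, ← add_assoc]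

/-- A gadget of size `N` for `f` is an affine determinantal representation of size `N`. [folklore] -/
theorem hasDetRepr_of_gadgetC {N : ℕ} {f : MvPolynomial σ R} (h : GadgetC[N, f]) :
    Literature.Computability.AlgebraicComplexity.HasDetRepr f N := by
  obtain ⟨ι, _, _, hN, z, M, hdeg, hdet⟩ := h
  subst hN
  refine ⟨Matrix.reindex (Fintype.equivFin ι) (Fintype.equivFin ι) M, fun i j => ?_, ?_⟩
  · rw [Matrix.reindex_apply, Matrix.submatrix_apply]
    exact hdeg _ _
  · rw [Matrix.det_reindex_self]
    simpa using hdet 0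

end Gadget

/-! ### The clique polynomial and its monotone shadow -/

section CliquePoly

open Finset

variable (m : ℕ)

/-- Indices (under the enumeration `eE m`) of the edges of `K_m` inside the vertex set `T`. [folklore] -/
noncomputable def liveIdx (T : Finset (Fin m)) : Finset (Fin (CliqueLPGate.nE m)) :=
  univ.filter fun i => IsLive T ((CliqueLPGate.eE m).symm i)

/-- The exponent vector of the clique monomial of `T`: the indicator of `liveIdx m T`. [folklore] -/
noncomputable def liveSupp (T : Finset (Fin m)) : Fin (CliqueLPGate.nE m) →₀ ℕ :=
  ∑ i ∈ liveIdx m T, Finsupp.single i 1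

/-- Coordinates of `liveSupp`. [folklore] -/
theorem liveSupp_apply (T : Finset (Fin m)) (i : Fin (CliqueLPGate.nE m)) :
    liveSupp m T i = if i ∈ liveIdx m T then 1 else 0 := by
  rw [liveSupp, Finsupp.finsetSum_apply]
  simp only [Finsupp.single_apply]
  rw [Finset.sum_ite_eq']

/-- Support of `liveSupp`. [folklore] -/
theorem mem_support_liveSupp (T : Finset (Fin m)) (i : Fin (CliqueLPGate.nE m)) :
    i ∈ (liveSupp m T).support ↔ IsLive T ((CliqueLPGate.eE m).symm i) := by
  rw [Finsupp.mem_support_iff, liveSupp_apply]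
  simp [liveIdx]

/-- The product of the live edge variables is the clique monomial. [folklore] -/
theorem prod_X_eq_monomial {R : Type*} [CommSemiring R] (S : Finset (Fin (CliqueLPGate.nE m))) :
    ∏ i ∈ S, (X i : MvPolynomial (Fin (CliqueLPGate.nE m)) R) =
      monomial (∑ i ∈ S, Finsupp.single i 1) 1 := by
  induction S using Finset.induction_on with
  | empty => simp
  | insert a S ha ih =>
    rw [Finset.prod_insert ha, Finset.sum_insert ha, ih, X, monomial_mul, one_mul]

variable (F : Type) [Field F]

/-- **The clique polynomial** `CL_{m,k} = ∑_{|T| = k} ∏_{e ⊆ T} X_e` over `F`, in the edge variables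
of `K_m` enumerated by `eE m` (Bürgisser 2000, §3: the clique family; here with all coefficients `1`). [folklore] -/
noncomputable def cliquePoly (k : ℕ) : MvPolynomial (Fin (CliqueLPGate.nE m)) F :=
  ∑ T ∈ powersetCard k univ, monomial (liveSupp m T) 1

variable {m F}

/-- For `|T|, |T'| ≥ 2`, equal live-edge sets force `T = T'`. [folklore] -/
theorem eq_of_liveSupp_eq {T T' : Finset (Fin m)} (hT : 2 ≤ T.card) (hT' : 2 ≤ T'.card)
    (h : liveSupp m T = liveSupp m T') : T = T' := by
  have key : ∀ {A B : Finset (Fin m)}, 2 ≤ A.card → liveSupp m A = liveSupp m B → A ⊆ B := by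
    intro A B hA hAB u hu
    obtain ⟨w, hw, hwu⟩ := Finset.exists_mem_ne (by omega : 1 < A.card) u
    have he : s(u, w) ∈ (⊤ : SimpleGraph (Fin m)).edgeSet := (SimpleGraph.mem_edgeSet _).2 hwu.symm
    have hlive : IsLive A ⟨s(u, w), he⟩ := (isLive_mk he).2 ⟨hu, hw⟩
    have h1 : (CliqueLPGate.eE m ⟨s(u, w), he⟩) ∈ (liveSupp m A).support := by
      rw [mem_support_liveSupp]; simpa using hlive
    rw [hAB, mem_support_liveSupp] at h1
    simp only [Equiv.symm_apply_apply] at h1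
    exact ((isLive_mk he).1 h1).1
  exact Finset.Subset.antisymm (key hT h) (key hT' h.symm)

/-- Coefficients of the clique polynomial (`k ≥ 2`): the clique monomials have coefficient `1`. [folklore] -/
theorem coeff_cliquePoly_liveSupp {k : ℕ} (hk : 2 ≤ k) {T : Finset (Fin m)} (hT : T.card = k) :
    coeff (liveSupp m T) (cliquePoly m F k) = 1 := by
  rw [cliquePoly, coeff_sum, Finset.sum_eq_single T]
  · simp
  · intro T' hT' hne
    rw [coeff_monomial, if_neg]
    intro h
    exact hne (eq_of_liveSupp_eq (by rw [(mem_powersetCard.1 hT').2]; exact hk) (by omega) h)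
  · intro h
    exact absurd (mem_powersetCard.2 ⟨subset_univ _, hT⟩) h

/-- The support of the clique polynomial (`k ≥ 2`) is the set of clique exponent vectors. [folklore] -/
theorem mem_support_cliquePoly_iff {k : ℕ} (hk : 2 ≤ k) (s : Fin (CliqueLPGate.nE m) →₀ ℕ) :
    s ∈ (cliquePoly m F k).support ↔ ∃ T : Finset (Fin m), T.card = k ∧ liveSupp m T = s := by
  constructor
  · intro hs
    rw [mem_support_iff, cliquePoly, coeff_sum] at hs
    obtain ⟨T, hT, hne⟩ := Finset.exists_ne_zero_of_sum_ne_zero hs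
    rw [coeff_monomial] at hne
    by_cases h : liveSupp m T = s
    · exact ⟨T, (mem_powersetCard.1 hT).2, h⟩
    · exact absurd (if_neg h) hne
  · rintro ⟨T, hT, rfl⟩
    rw [mem_support_iff, coeff_cliquePoly_liveSupp hk hT]
    exact one_ne_zero

/-- **The monotone shadow of the clique polynomial is CLIQUE** (`k ≥ 2`): some monomial of
`CL_{m,k}` has all its variables on in `x` iff `x` spans a `k`-clique. [folklore] -/
theorem shadow_cliquePoly_iff {k : ℕ} (hk : 2 ≤ k) (x : (⊤ : SimpleGraph (Fin m)).edgeSet → Bool) :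
    (∃ s ∈ (cliquePoly m F k).support, ∀ i ∈ s.support, x ((CliqueLPGate.eE m).symm i) = true) ↔
      cliqueFn m k x = true := by
  rw [cliqueFn_eq_true_iff_exists]
  constructor
  · rintro ⟨s, hs, hx⟩
    obtain ⟨T, hT, rfl⟩ := (mem_support_cliquePoly_iff hk s).1 hs
    refine ⟨T, hT, fun e he => ?_⟩
    have := hx (CliqueLPGate.eE m e) (by rw [mem_support_liveSupp]; simpa using he)
    simpa using this
  · rintro ⟨T, hT, hx⟩
    refine ⟨liveSupp m T, (mem_support_cliquePoly_iff hk _).2 ⟨T, hT, rfl⟩, fun i hi => ?_⟩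
    exact hx _ ((mem_support_liveSupp m T i).1 hi)

/-- In contrast, for `k ≤ 1` the clique polynomial is the CONSTANT `C(m, k)`, which vanishes in
characteristic `p ∣ C(m,k)` although `CLIQUE(m, k) ≡ 1` (`m ≥ 1`): the hypothesis `2 ≤ k` above is
necessary. [folklore] -/
theorem cliquePoly_of_le_one {k : ℕ} (hk : k ≤ 1) :
    cliquePoly m F k = C ((m.choose k : ℕ) : F) := by
  have h0 : ∀ T ∈ powersetCard k (univ : Finset (Fin m)), liveSupp m T = 0 := by
    intro T hT
    ext i
    rw [liveSupp_apply, Finsupp.coe_zero, Pi.zero_apply]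
    rw [if_neg]
    simp only [liveIdx, mem_filter, mem_univ, true_and]
    intro hlive
    have hc : T.card ≤ 1 := by rw [(mem_powersetCard.1 hT).2]; exact hk
    revert hlive
    refine edge_ind (P := fun e => IsLive T e → False) (fun u v huv hl => ?_) _
    rw [isLive_mk] at hl
    exact huv (Finset.card_le_one.1 hc u hl.1 v hl.2)
  rw [cliquePoly, Finset.sum_congr rfl fun T hT => by rw [h0 T hT], Finset.sum_const,
    card_powersetCard, card_univ, Fintype.card_fin, ← C_apply, C_1, nsmul_eq_mul, mul_one]
  exact (map_natCast C _).symm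

/-- **`dc(CL_{m,k}) ≤ 1 + C(m,k) · #E(K_m)`**: an explicit affine determinantal representation of
the clique polynomial (one Valiant path block per `k`-set). [folklore] -/
theorem hasDetRepr_cliquePoly (k : ℕ) :
    Literature.Computability.AlgebraicComplexity.HasDetRepr (cliquePoly m F k)
      (1 + m.choose k * CliqueLPGate.nE m) := by
  classical
  let ls : Finset (Fin m) → List (MvPolynomial (Fin (CliqueLPGate.nE m)) F) := fun T =>
    (liveIdx m T).toList.map X
  have hprod : ∀ T, (ls T).prod = monomial (liveSupp m T) 1 := fun T => by
    simp only [ls, Finset.prod_map_toList, liveSupp, prod_X_eq_monomial]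
  obtain ⟨N', hN', hG⟩ := gadgetC_add_sum_listProd (powersetCard k (univ : Finset (Fin m))) ls
    (CliqueLPGate.nE m) (fun T _ y hy => by
      obtain ⟨i, -, rfl⟩ := List.mem_map.1 hy
      exact (isHomogeneous_X F i).totalDegree_le)
    (fun T _ => by
      simp only [ls, List.length_map, Finset.length_toList]
      exact (Finset.card_filter_le _ _).trans (by simp))
    gadgetC_zero
  have hrepr := hasDetRepr_of_gadgetC hG
  simp only [hprod, zero_add] at hrepr
  rw [card_powersetCard, card_univ, Fintype.card_fin] at hN'
  exact Literature.Computability.AlgebraicComplexity.HasDetRepr.mono_holds hrepr hN'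

end CliquePoly

end Summit.PneNP.PneNP.Theorems.LinAlgGateBlind.Negative
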